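import Mathlib
import HarnessLib.Audit
import Summits.PneNP.PneNP.Theorems.PstarChordReadShared
import Summits.PneNP.PneNP.Theorems.PstarChordReadGates

/-!
# Shared switch partners: the two-partner move, and the twisted type II / III kills (ROUND-24, O1 at exact tightness; memo g20 §13.7, residual R2)

FRONTIER range-avoidance ladder, rung F-N3, ROUND 24 (cell `pnp-ideate`, prover-2 memo `g20/O1-CHORD-READ-g20.md` §13.3/§13.7 (residual R2: a private gate
`(p, z)` whose partner `z` also sits in a gate `(σ, z)`); typed target `PstarCoreBoundTargets.TerminalPeelable` (p646951); restricted-model proof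
complexity — nothing here bears on `P` versus `NP`).

Completes the semantic type kills of `PstarChordReadShared` (type I) for the shared menu:

* `coef_switch₂` / `gval_flip_switch₂` — the move of a switch `z` carrying TWO gates `g = (v, z)`, `g' = (σ, z)`:
  `[z ∈ C] ⊕ ([g ∈ G] ∧ x_v) ⊕ ([g' ∈ G] ∧ x_σ)` (the syntactic source of the twisted live condition `x_p = τ ⊕ μ x_σ`);
* `false_of_shared_typeII` — type I with the readers exchanged;
* `twistedLocal_of_fail_live` — a reader (any `(C, G, b)` with monomials in a menu avoiding the privates) that fails at `x[p := τ ⊕ μ x_σ]` for every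
  solution `x` on `{x_q = 0}` is twisted-local (the abstract form of `twistedLocal_of_switch`);
* `false_of_gval_eq_add_var` — `Γ₂ = Γ₁ ⊕ x_σ` is impossible next to a switch moving `Γ₁` on the twisted slice (at a solution with `x_σ = b₁ ⊕ b₂`,
  which slice genericity supplies, the point or its flip satisfies both readers);
* `false_of_shared_typeIII` — TWISTED TYPE III: two distinct non-parallel chords, slice-generic for the menu `G₁ △ G₂` of the sum reader (whose
  monomials avoid their privates), each with an outside switch moving BOTH readers on its twisted slice ⟹ the sum reader is twisted-local at both
  ⟹ `Γ₂ = Γ₁ ⊕ ε x_σ` ⟹ dead (`false_of_gval_eq` / `false_of_gval_eq_add_var`).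

No Assumption A.  What remains for R2 (memo §13.7): deriving the uniform type from RANK ONE with the census fact "σ takes both values on a suitable
double slice" (kit j317676: always available) as the realisability input.
-/

set_option linter.dupNamespace false -- `Summit.PneNP.PneNP.…`: summit = sub-problem name (D-0017 single-conjunct layout)

open Finset Literature.Computability.Complexity
open scoped symmDiff
open Summit.PneNP.PneNP.Theorems.PstarFibrePolys (bit bit_injective bit_xor)
open Summit.PneNP.PneNP.Theorems.PstarTyped (Typed)
open Summit.PneNP.PneNP.Theorems.PstarSALevel (varSet bdry BoundaryExpanding SimpleOverlap)
open Summit.PneNP.PneNP.Theorems.PstarCentreFree (vars_mem_varSet)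
open Summit.PneNP.PneNP.Theorems.PstarGapOneAll (gval)
open Summit.PneNP.PneNP.Theorems.PstarGConstraint (gval_update_of_forall_ne)
open Summit.PneNP.PneNP.Theorems.PstarChordRepair (IsChord)
open Summit.PneNP.PneNP.Theorems.PstarCoreBoundTargets (Terminal)
open Summit.PneNP.PneNP.Theorems.PstarChordBridgeTools (coef)
open Summit.PneNP.PneNP.Theorems.PstarChordReadsGates (gval_update_not_coef)
open Summit.PneNP.PneNP.Theorems.PstarGSystemFreeVar (gval_symmDiff)
open Summit.PneNP.PneNP.Theorems.PstarFreshEraseGates (terminal_symm)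
open Summit.PneNP.PneNP.Theorems.PstarChordReads (solves_update_of_chord)
open Summit.PneNP.PneNP.Theorems.PstarChordReadsMirror (solves_set_privates)
open Summit.PneNP.PneNP.Theorems.PstarChordReadLemma (ChordLocal SliceGeneric chordLocal_of_fail_slice)
open Summit.PneNP.PneNP.Theorems.PstarChordReadSwitch (solves_update_of_outside false_of_gval_eq xor_gval_of_switch_both)
open Summit.PneNP.PneNP.Theorems.PstarChordReadShared

namespace Summit.PneNP.PneNP.Theorems.PstarChordReadSharedTypes

variable {n m : ℕ}

/-- `G₁ ∆ G₂ ⊆ G₁ ∪ G₂`. -/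
private theorem symmDiff_subset_union' (G₁ G₂ : Finset (Fin m)) : G₁ ∆ G₂ ⊆ G₁ ∪ G₂ := fun g hg => by
  rcases Finset.mem_symmDiff.1 hg with ⟨h, -⟩ | ⟨h, -⟩
  · exact mem_union_left _ h
  · exact mem_union_right _ h

/-! ## The two-partner move -/
section Switch₂

variable (I : LocalMap 4 n m) {C : Finset (Fin n)} {G : Finset (Fin m)} {g g' : Fin m} {v σ z : Fin n}

/-- **Read coefficient of a switch with two gates**: if the only monomials of `G` that may contain `z` are `g = (v, z)` and `g' = (σ, z)` (`g ≠ g'`),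
then `coef z = [z ∈ C] + [g ∈ G]·x_v + [g' ∈ G]·x_σ`. -/
theorem coef_switch₂ (hgg : g ≠ g') (hvz : v ≠ z) (hσz : σ ≠ z)
    (hg : (I.vars g 2 = v ∧ I.vars g 3 = z) ∨ (I.vars g 2 = z ∧ I.vars g 3 = v))
    (hg' : (I.vars g' 2 = σ ∧ I.vars g' 3 = z) ∨ (I.vars g' 2 = z ∧ I.vars g' 3 = σ))
    (hother : ∀ h ∈ G, h ≠ g → h ≠ g' → I.vars h 2 ≠ z ∧ I.vars h 3 ≠ z) (X : Fin n → ZMod 2) :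
    coef I C G z X = (if z ∈ C then 1 else 0) + (if g ∈ G then X v else 0) + (if g' ∈ G then X σ else 0) := by
  classical
  unfold coef
  rw [add_assoc]
  congr 1
  -- the summand of each output
  set F : Fin m → ZMod 2 := fun h => (if I.vars h 2 = z then X (I.vars h 3) else 0) + (if I.vars h 3 = z then X (I.vars h 2) else 0) with hF
  have hFg : F g = X v := by
    rcases hg with ⟨h2, h3⟩ | ⟨h2, h3⟩
    · simp only [hF, h2, h3, if_neg hvz, if_true, zero_add]
    · simp only [hF, h2, h3, if_true, if_neg hvz, add_zero]
  have hFg' : F g' = X σ := by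
    rcases hg' with ⟨h2, h3⟩ | ⟨h2, h3⟩
    · simp only [hF, h2, h3, if_neg hσz, if_true, zero_add]
    · simp only [hF, h2, h3, if_true, if_neg hσz, add_zero]
  have hF0 : ∀ h ∈ G, h ≠ g → h ≠ g' → F h = 0 := by
    intro h hh h1 h2
    simp only [hF, if_neg (hother h hh h1 h2).1, if_neg (hother h hh h1 h2).2, add_zero]
  show ∑ h ∈ G, F h = _
  by_cases hgG : g ∈ G
  · rw [if_pos hgG, ← add_sum_erase G _ hgG, hFg]
    by_cases hg'G : g' ∈ G
    · rw [if_pos hg'G, ← add_sum_erase (G.erase g) _ (mem_erase.2 ⟨hgg.symm, hg'G⟩), hFg',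
        sum_eq_zero (fun h hh => hF0 h (mem_of_mem_erase (mem_of_mem_erase hh)) (ne_of_mem_erase (mem_of_mem_erase hh)) (ne_of_mem_erase hh)),
        add_zero]
    · rw [if_neg hg'G, add_zero, sum_eq_zero (fun h hh => hF0 h (mem_of_mem_erase hh) (ne_of_mem_erase hh) (fun e => hg'G (e ▸ mem_of_mem_erase hh))),
        add_zero]
  · rw [if_neg hgG, zero_add]
    by_cases hg'G : g' ∈ G
    · rw [if_pos hg'G, ← add_sum_erase G _ hg'G, hFg',
        sum_eq_zero (fun h hh => hF0 h (mem_of_mem_erase hh) (fun e => hgG (e ▸ mem_of_mem_erase hh)) (ne_of_mem_erase hh)), add_zero]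
    · rw [if_neg hg'G]
      exact sum_eq_zero fun h hh => hF0 h hh (fun e => hgG (e ▸ hh)) (fun e => hg'G (e ▸ hh))

/-- **Flipping a switch with two gates**: `gval (x with z flipped) = gval x ⊕ [z ∈ C] ⊕ ([g ∈ G] ∧ x_v) ⊕ ([g' ∈ G] ∧ x_σ)`. -/
theorem gval_flip_switch₂ (hI : I.IsPure xorAndPred) (hgg : g ≠ g') (hvz : v ≠ z) (hσz : σ ≠ z)
    (hg : (I.vars g 2 = v ∧ I.vars g 3 = z) ∨ (I.vars g 2 = z ∧ I.vars g 3 = v))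
    (hg' : (I.vars g' 2 = σ ∧ I.vars g' 3 = z) ∨ (I.vars g' 2 = z ∧ I.vars g' 3 = σ))
    (hother : ∀ h ∈ G, h ≠ g → h ≠ g' → I.vars h 2 ≠ z ∧ I.vars h 3 ≠ z) (x : Fin n → Bool) :
    gval I C G (Function.update x z (!x z)) =
      xor (gval I C G x) (xor (xor (decide (z ∈ C)) (decide (g ∈ G) && x v)) (decide (g' ∈ G) && x σ)) := by
  classical
  rw [gval_update_not_coef I hI C G x z, coef_switch₂ I hgg hvz hσz hg hg' hother]
  by_cases hC : z ∈ C <;> by_cases hG : g ∈ G <;> by_cases hG' : g' ∈ G <;>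
    simp only [hC, hG, hG', if_true, if_false, decide_true, decide_false] <;>
    cases x v <;> cases x σ <;> cases gval I C G x <;> simp [bit] <;> decide

end Switch₂

section Main

variable {I : LocalMap 4 n m} {r : ℕ} {y : Fin m → Bool} {J₀ : Finset (Fin m)} {w₁ w₂ : Finset (Fin n) × Finset (Fin m) × Bool}

/-- **TWISTED TYPE II**: type I with the readers exchanged. -/
theorem false_of_shared_typeII (hI : I.IsPure xorAndPred) (hT : Typed I) (hS : SimpleOverlap I) (hB : BoundaryExpanding r I)
    (ht : Terminal I r y J₀ w₁ w₂) {cᵢ cⱼ : Fin m} (hcᵢ : cᵢ ∈ J₀) (hcⱼ : cⱼ ∈ J₀) (hne : cᵢ ≠ cⱼ) (hchᵢ : IsChord I J₀ cᵢ)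
    (hchⱼ : IsChord I J₀ cⱼ) (hv : ∃ s : Fin 4, s.val < 2 ∧ I.vars cᵢ s ∉ varSet I cⱼ)
    (hmonoᵢ : ∀ g ∈ w₁.2.1, (I.vars g 2 ≠ I.vars cᵢ 2 ∧ I.vars g 3 ≠ I.vars cᵢ 2) ∧ (I.vars g 2 ≠ I.vars cᵢ 3 ∧ I.vars g 3 ≠ I.vars cᵢ 3))
    (hmonoⱼ : ∀ g ∈ w₁.2.1, (I.vars g 2 ≠ I.vars cⱼ 2 ∧ I.vars g 3 ≠ I.vars cⱼ 2) ∧ (I.vars g 2 ≠ I.vars cⱼ 3 ∧ I.vars g 3 ≠ I.vars cⱼ 3))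
    (hgenᵢ : SliceGeneric I y J₀ cᵢ w₁.2.1) (hgenⱼ : SliceGeneric I y J₀ cⱼ w₁.2.1)
    {zᵢ zⱼ σᵢ σⱼ : Fin n} (hzᵢ : ∀ j ∈ J₀, zᵢ ∉ varSet I j) (hzᵢC : zᵢ ∉ w₁.1) (hzᵢG : ∀ g ∈ w₁.2.1, I.vars g 2 ≠ zᵢ ∧ I.vars g 3 ≠ zᵢ)
    (hzⱼ : ∀ j ∈ J₀, zⱼ ∉ varSet I j) (hzⱼC : zⱼ ∉ w₁.1) (hzⱼG : ∀ g ∈ w₁.2.1, I.vars g 2 ≠ zⱼ ∧ I.vars g 3 ≠ zⱼ)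
    (hzσ : zᵢ ≠ σᵢ) (hσᵢᵢ : σᵢ ∉ varSet I cᵢ) (hσⱼᵢ : σⱼ ∉ varSet I cᵢ) (hσⱼⱼ : σⱼ ∉ varSet I cⱼ) (τᵢ μᵢ τⱼ μⱼ : Bool)
    (hmoveᵢ : ∀ x : Fin n → Bool, (∀ j ∈ J₀, I.eval x j = y j) → x (I.vars cᵢ 3) = false → x (I.vars cᵢ 2) = xor τᵢ (μᵢ && x σᵢ) →
      gval I w₂.1 w₂.2.1 (Function.update x zᵢ (!x zᵢ)) ≠ gval I w₂.1 w₂.2.1 x)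
    (hmoveⱼ : ∀ x : Fin n → Bool, (∀ j ∈ J₀, I.eval x j = y j) → x (I.vars cⱼ 3) = false → x (I.vars cⱼ 2) = xor τⱼ (μⱼ && x σⱼ) →
      gval I w₂.1 w₂.2.1 (Function.update x zⱼ (!x zⱼ)) ≠ gval I w₂.1 w₂.2.1 x) : False :=
  false_of_shared_typeI hI hT hS hB (terminal_symm ht) hcᵢ hcⱼ hne hchᵢ hchⱼ hv hmonoᵢ hmonoⱼ hgenᵢ hgenⱼ hzᵢ hzᵢC hzᵢG hzⱼ hzⱼC hzⱼG hzσ hσᵢᵢ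
    hσⱼᵢ hσⱼⱼ τᵢ μᵢ τⱼ μⱼ hmoveᵢ hmoveⱼ

/-- **A reader failing at the live point of every solution on `{x_q = 0}` is twisted-local** (abstract form of `twistedLocal_of_switch`, for any
reader `(C, G, b)` whose monomials lie in a menu avoiding the privates of `c`). -/
theorem twistedLocal_of_fail_live (hI : I.IsPure xorAndPred) {c : Fin m} (hc : c ∈ J₀) (hch : IsChord I J₀ c) {C : Finset (Fin n)}
    {G : Finset (Fin m)} (hmono : ∀ g ∈ G, (I.vars g 2 ≠ I.vars c 2 ∧ I.vars g 3 ≠ I.vars c 2) ∧ (I.vars g 2 ≠ I.vars c 3 ∧ I.vars g 3 ≠ I.vars c 3))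
    (hgen : SliceGeneric I y J₀ c G) {σ : Fin n} (τ μ b : Bool)
    (hfail : ∀ x : Fin n → Bool, (∀ j ∈ J₀, I.eval x j = y j) → x (I.vars c 3) = false →
      gval I C G (Function.update x (I.vars c 2) (xor τ (μ && x σ))) ≠ b) :
    TwistedLocal I c σ C G := by
  classical
  have hmono₂ : ∀ g ∈ G, I.vars g 2 ≠ I.vars c 2 ∧ I.vars g 3 ≠ I.vars c 2 := fun g hg => (hmono g hg).1
  by_cases hp : I.vars c 2 ∈ C
  · cases μ
    · have hloc : ChordLocal I c (C.erase (I.vars c 2)) G := by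
        refine chordLocal_of_fail_slice hI hc hch hgen hmono (Subset.refl _) false false (xor b τ) fun x hx hp0 hq h => ?_
        refine hfail x hx hq ?_
        rw [gval_erase_lin I (by simpa using hp) G, Function.update_self, gval_update_of_forall_ne I x (notMem_erase _ _) hmono₂, h]
        cases b <;> cases τ <;> cases x σ <;> decide
      obtain ⟨φ, hφ⟩ := hloc
      refine ⟨fun s u v => xor (φ s u v) u, false, fun x => ?_⟩
      rw [gval_erase_lin I hp, hφ x]
      dsimp only
      rw [Bool.false_and, Bool.xor_false]
    · have hloc : ChordLocal I c ((C.erase (I.vars c 2)) ∆ {σ}) G := by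
        refine chordLocal_of_fail_slice hI hc hch hgen hmono (Subset.refl _) false false (xor b τ) fun x hx hp0 hq h => ?_
        refine hfail x hx hq ?_
        rw [gval_erase_lin I (by simpa using hp) G, Function.update_self, gval_update_of_forall_ne I x (notMem_erase _ _) hmono₂]
        rw [gval_symmDiff_singleton] at h
        revert h
        cases gval I (C.erase (I.vars c 2)) G x <;> cases b <;> cases τ <;> cases x σ <;> decide
      obtain ⟨φ, hφ⟩ := hloc
      refine ⟨fun s u v => xor (φ s u v) u, true, fun x => ?_⟩
      have h := hφ x
      rw [gval_symmDiff_singleton] at h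
      rw [gval_erase_lin I hp]
      dsimp only
      revert h
      generalize φ (xor (x (I.vars c 0)) (x (I.vars c 1))) (x (I.vars c 2)) (x (I.vars c 3)) = f
      cases gval I (C.erase (I.vars c 2)) G x <;> cases f <;> cases x (I.vars c 2) <;> cases x σ <;> decide
  · have hloc : ChordLocal I c C G := by
      refine chordLocal_of_fail_slice hI hc hch hgen hmono (Subset.refl _) false false b fun x hx hp0 hq h => ?_
      refine hfail x hx hq ?_
      rw [gval_update_of_forall_ne I x hp hmono₂, h]
    obtain ⟨φ, hφ⟩ := hloc
    exact ⟨φ, false, fun x => by rw [hφ x, Bool.false_and, Bool.xor_false]⟩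

/-- **`Γ₂ = Γ₁ ⊕ x_σ` is impossible next to a switch moving `Γ₁` on the twisted slice**: at a solution with `x_q = 0`, live `x_p` and
`x_σ = b₁ ⊕ b₂` (slice genericity), the point or its `z`-flip satisfies `Γ₁`, hence both readers. -/
theorem false_of_gval_eq_add_var (hI : I.IsPure xorAndPred) (ht : Terminal I r y J₀ w₁ w₂) {c : Fin m} (hc : c ∈ J₀) (hch : IsChord I J₀ c)
    {𝒢 : Finset (Fin m)} (hgen : SliceGeneric I y J₀ c 𝒢) {z σ : Fin n} (hz : ∀ j ∈ J₀, z ∉ varSet I j) (hzσ : z ≠ σ) (hσ : σ ∉ varSet I c)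
    (τ μ : Bool)
    (hmove : ∀ x : Fin n → Bool, (∀ j ∈ J₀, I.eval x j = y j) → x (I.vars c 3) = false → x (I.vars c 2) = xor τ (μ && x σ) →
      gval I w₁.1 w₁.2.1 (Function.update x z (!x z)) ≠ gval I w₁.1 w₁.2.1 x)
    (h₂ : ∀ x : Fin n → Bool, gval I w₂.1 w₂.2.1 x = xor (gval I w₁.1 w₁.2.1 x) (x σ)) : False := by
  classical
  have h23 : I.vars c 2 ≠ I.vars c 3 := fun h => absurd (hI.2 c h) (by decide)
  have hσp : σ ≠ I.vars c 2 := fun e => hσ (e ▸ vars_mem_varSet I c 2)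
  have hσq : σ ≠ I.vars c 3 := fun e => hσ (e ▸ vars_mem_varSet I c 3)
  have hσ0 : σ ≠ I.vars c 0 := fun e => hσ (e ▸ vars_mem_varSet I c 0)
  have hσ1 : σ ≠ I.vars c 1 := fun e => hσ (e ▸ vars_mem_varSet I c 1)
  -- a solution of `J₀ ∖ c` on the slice `t = y_c` with `x_σ = b₁ ⊕ b₂`
  obtain ⟨x₀, hx₀, hab, hxσ⟩ : ∃ x : Fin n → Bool, (∀ j ∈ J₀.erase c, I.eval x j = y j) ∧
      xor (x (I.vars c 0)) (x (I.vars c 1)) = y c ∧ x σ = xor w₁.2.2 w₂.2.2 := by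
    by_contra hno
    push Not at hno
    obtain ⟨φ, hφ⟩ := hgen {σ} ∅ (y c) (xor w₁.2.2 w₂.2.2) (by simpa using hσp.symm) (by simpa using hσq.symm) (empty_subset _)
      (fun x hx hxab h => hno x hx hxab (by rw [← h, gval_singleton]))
    have h0 := hφ (fun _ => false)
    have h1 := hφ (Function.update (fun _ => false) σ true)
    rw [gval_singleton] at h0 h1
    rw [Function.update_self, Function.update_of_ne hσ0.symm, Function.update_of_ne hσ1.symm] at h1
    rw [← h0] at h1
    exact Bool.noConfusion h1
  have hab' : xor (xor (x₀ (I.vars c 0)) (x₀ (I.vars c 1))) ((xor τ (μ && xor w₁.2.2 w₂.2.2)) && false) = y c := by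
    rw [Bool.and_false, Bool.xor_false, hab]
  have hx := solves_set_privates hI hc hch hx₀ (xor τ (μ && xor w₁.2.2 w₂.2.2)) false hab'
  set x := Function.update (Function.update x₀ (I.vars c 2) (xor τ (μ && xor w₁.2.2 w₂.2.2))) (I.vars c 3) false with hxdef
  have hxq : x (I.vars c 3) = false := by rw [hxdef, Function.update_self]
  have hxσ' : x σ = xor w₁.2.2 w₂.2.2 := by rw [hxdef, Function.update_of_ne hσq, Function.update_of_ne hσp, hxσ]
  have hxp : x (I.vars c 2) = xor τ (μ && x σ) := by rw [hxσ', hxdef, Function.update_of_ne h23, Function.update_self]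
  have hm := hmove x hx hxq hxp
  have hx' := solves_update_of_outside hz hx (!x z)
  have e₂ := h₂ x
  have e₂' := h₂ (Function.update x z (!x z))
  rw [hxσ'] at e₂
  rw [Function.update_of_ne hzσ.symm, hxσ'] at e₂'
  have T := ht.2.2.2.2.2.2.1
  have A := fun (a : gval I w₁.1 w₁.2.1 x = w₁.2.2) (b : gval I w₂.1 w₂.2.1 x = w₂.2.2) => T ⟨x, hx, a, b⟩
  have B := fun (a : gval I w₁.1 w₁.2.1 (Function.update x z (!x z)) = w₁.2.2)
    (b : gval I w₂.1 w₂.2.1 (Function.update x z (!x z)) = w₂.2.2) => T ⟨_, hx', a, b⟩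
  revert A B hm e₂ e₂'
  cases gval I w₁.1 w₁.2.1 (Function.update x z (!x z)) <;> cases gval I w₁.1 w₁.2.1 x <;>
    cases gval I w₂.1 w₂.2.1 (Function.update x z (!x z)) <;> cases gval I w₂.1 w₂.2.1 x <;> cases w₁.2.2 <;> cases w₂.2.2 <;> decide

/-- **TWISTED TYPE III KILL (residual R2, semantic form).**  Two distinct non-parallel chords, slice-generic for the menu `G₁ △ G₂` of the sum reader
(whose monomials avoid their privates), each with an outside switch `zᵢ, zⱼ` moving BOTH readers on its twisted slice `x_q = 0, x_p = τ ⊕ μ x_σ`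
(`σ`'s outside both chords, `zᵢ ≠ σᵢ`): the terminal core is dead. -/
theorem false_of_shared_typeIII (hI : I.IsPure xorAndPred) (hT : Typed I) (hS : SimpleOverlap I) (hB : BoundaryExpanding r I)
    (ht : Terminal I r y J₀ w₁ w₂) {cᵢ cⱼ : Fin m} (hcᵢ : cᵢ ∈ J₀) (hcⱼ : cⱼ ∈ J₀) (hne : cᵢ ≠ cⱼ) (hchᵢ : IsChord I J₀ cᵢ)
    (hchⱼ : IsChord I J₀ cⱼ) (hv : ∃ s : Fin 4, s.val < 2 ∧ I.vars cᵢ s ∉ varSet I cⱼ)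
    (hmonoᵢ : ∀ g ∈ w₁.2.1 ∆ w₂.2.1, (I.vars g 2 ≠ I.vars cᵢ 2 ∧ I.vars g 3 ≠ I.vars cᵢ 2) ∧ (I.vars g 2 ≠ I.vars cᵢ 3 ∧ I.vars g 3 ≠ I.vars cᵢ 3))
    (hmonoⱼ : ∀ g ∈ w₁.2.1 ∆ w₂.2.1, (I.vars g 2 ≠ I.vars cⱼ 2 ∧ I.vars g 3 ≠ I.vars cⱼ 2) ∧ (I.vars g 2 ≠ I.vars cⱼ 3 ∧ I.vars g 3 ≠ I.vars cⱼ 3))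
    (hgenᵢ : SliceGeneric I y J₀ cᵢ (w₁.2.1 ∆ w₂.2.1)) (hgenⱼ : SliceGeneric I y J₀ cⱼ (w₁.2.1 ∆ w₂.2.1))
    {zᵢ zⱼ σᵢ σⱼ : Fin n} (hzᵢ : ∀ j ∈ J₀, zᵢ ∉ varSet I j) (hzⱼ : ∀ j ∈ J₀, zⱼ ∉ varSet I j)
    (hzσ : zᵢ ≠ σᵢ) (hσᵢᵢ : σᵢ ∉ varSet I cᵢ) (hσⱼᵢ : σⱼ ∉ varSet I cᵢ) (hσⱼⱼ : σⱼ ∉ varSet I cⱼ) (τᵢ μᵢ τⱼ μⱼ : Bool)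
    (hmoveᵢ : ∀ x : Fin n → Bool, (∀ j ∈ J₀, I.eval x j = y j) → x (I.vars cᵢ 3) = false → x (I.vars cᵢ 2) = xor τᵢ (μᵢ && x σᵢ) →
      gval I w₁.1 w₁.2.1 (Function.update x zᵢ (!x zᵢ)) ≠ gval I w₁.1 w₁.2.1 x ∧
      gval I w₂.1 w₂.2.1 (Function.update x zᵢ (!x zᵢ)) ≠ gval I w₂.1 w₂.2.1 x)
    (hmoveⱼ : ∀ x : Fin n → Bool, (∀ j ∈ J₀, I.eval x j = y j) → x (I.vars cⱼ 3) = false → x (I.vars cⱼ 2) = xor τⱼ (μⱼ && x σⱼ) →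
      gval I w₁.1 w₁.2.1 (Function.update x zⱼ (!x zⱼ)) ≠ gval I w₁.1 w₁.2.1 x ∧
      gval I w₂.1 w₂.2.1 (Function.update x zⱼ (!x zⱼ)) ≠ gval I w₂.1 w₂.2.1 x) : False := by
  classical
  -- the sum reader fails at the live point of every solution on the slice, for both chords
  have hsum : ∀ {c : Fin m} {z σ : Fin n} (τ μ : Bool), c ∈ J₀ → IsChord I J₀ c →
      (∀ g ∈ w₁.2.1 ∆ w₂.2.1, (I.vars g 2 ≠ I.vars c 2 ∧ I.vars g 3 ≠ I.vars c 2) ∧ (I.vars g 2 ≠ I.vars c 3 ∧ I.vars g 3 ≠ I.vars c 3)) →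
      SliceGeneric I y J₀ c (w₁.2.1 ∆ w₂.2.1) → (∀ j ∈ J₀, z ∉ varSet I j) → σ ∉ varSet I c →
      (∀ x : Fin n → Bool, (∀ j ∈ J₀, I.eval x j = y j) → x (I.vars c 3) = false → x (I.vars c 2) = xor τ (μ && x σ) →
        gval I w₁.1 w₁.2.1 (Function.update x z (!x z)) ≠ gval I w₁.1 w₁.2.1 x ∧
        gval I w₂.1 w₂.2.1 (Function.update x z (!x z)) ≠ gval I w₂.1 w₂.2.1 x) →
      TwistedLocal I c σ (w₁.1 ∆ w₂.1) (w₁.2.1 ∆ w₂.2.1) := by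
    intro c z σ τ μ hc hch hmono hgen hz hσ hmove
    have h23 : I.vars c 2 ≠ I.vars c 3 := fun h => absurd (hI.2 c h) (by decide)
    have hσp : σ ≠ I.vars c 2 := fun e => hσ (e ▸ vars_mem_varSet I c 2)
    refine twistedLocal_of_fail_live hI hc hch hmono hgen τ μ (xor w₁.2.2 w₂.2.2) fun x hx hq h => ?_
    have hx' := solves_update_of_chord hI hc hch hx hq (xor τ (μ && x σ))
    have hm := hmove _ hx' (by rw [Function.update_of_ne h23.symm]; exact hq) (by rw [Function.update_self, Function.update_of_ne hσp])
    have hb := xor_gval_of_switch_both ht hz hx' hm.1 hm.2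
    rw [gval_symmDiff] at h
    rw [h] at hb
    revert hb; cases w₁.2.2 <;> cases w₂.2.2 <;> decide
  have hᵢ := hsum τᵢ μᵢ hcᵢ hchᵢ hmonoᵢ hgenᵢ hzᵢ hσᵢᵢ hmoveᵢ
  have hⱼ := hsum τⱼ μⱼ hcⱼ hchⱼ hmonoⱼ hgenⱼ hzⱼ hσⱼⱼ hmoveⱼ
  obtain ⟨ε, hε⟩ := eq_var_of_two_twistedLocal hI hcᵢ hcⱼ hne hchᵢ hv hσᵢᵢ hσⱼᵢ hᵢ hⱼ
  have hrel : ∀ x : Fin n → Bool, gval I w₂.1 w₂.2.1 x = xor (gval I w₁.1 w₁.2.1 x) (ε && x σᵢ) := fun x => by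
    have h := hε x
    rw [gval_symmDiff] at h
    revert h; cases gval I w₁.1 w₁.2.1 x <;> cases gval I w₂.1 w₂.2.1 x <;> cases (ε && x σᵢ) <;> decide
  cases ε
  · exact false_of_gval_eq hI hT hS hB ht fun x => by rw [hrel x, Bool.false_and, Bool.xor_false]
  · exact false_of_gval_eq_add_var hI ht hcᵢ hchᵢ hgenᵢ hzᵢ hzσ hσᵢᵢ τᵢ μᵢ (fun x hx hq hp => (hmoveᵢ x hx hq hp).1)
      fun x => by rw [hrel x, Bool.true_and]

end Main

end Summit.PneNP.PneNP.Theorems.PstarChordReadSharedTypes
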